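import Mathlib
import Summits.NavierStokesRegularity.NavierStokesRegularity.Theorems.EulerZoomLiouvillePowerGaugeEulerLiouvilleBirthDefsTwo
import HarnessLib

/-!
# Crux `EulerZoomLiouville.PowerGaugeEulerLiouville` (stmt-NavierStokesRegularity-19832): the binder predicates of the
# LEAD skeleton, part 3 of 3 (`IsHelicalTubePast` … `IsWeakConfinedCurl`)

Continuation of `…BirthDefsTwo` (same namespace `…Theorems.PowerGaugeEulerLiouville.Birth`): lines 628–924 of the LEAD skeleton
`Cruxes/PowerGaugeEulerLiouville/Lines/birth.lean` v115 (commit 97807a79e132), VERBATIM.  Importing THIS module gives all 52 predicates.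
Credits / senses: the LEAD's `CENSUS-19832-vNN.md`.

WHAT THIS IS NOT: not NS, not E — DEFINITIONS ONLY; the crux 19832 stays OPEN.
-/

noncomputable section

open MeasureTheory Set Filter Topology Metric
open scoped ENNReal NNReal ContDiff

-- flat `Theorems/<Route><Decl>…` files of one crux share the namespace of the crux (tree convention)
set_option linter.dupNamespace false

namespace Summit.NavierStokesRegularity.NavierStokesRegularity.Theorems.PowerGaugeEulerLiouville.Birth

/-- HELICAL TUBE IN A DRIFTING PAST (v52/v59; line `helicity-tube` of ns-idea-11 g4; ns-ezl-w5 g0 `HelicityTube.…_free`, ns-sfl-p1 g4 p636392): classical Euler on `(−∞,0)`,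
drift `‖u(τ,x)‖ ≤ M(−τ)^{−κ}` for `τ < T₁ ≤ 0`, `(1−3ρ)/(2−3ρ) < κ < 1`, and at some `τ < T₁` a smooth cut-off adapted to the vorticity with NON-ZERO partial helicity
(Moffatt invariance p628643 vs the gauges' zero-helicity law p627972). -/
@[reducible] def IsHelicalTubePast (ρ : ℝ) (u : ℝ → E3 → E3) (p : ℝ → E3 → ℝ) : Prop :=
  ∃ T₁ M κ : ℝ,
    (Literature.Analysis.FluidPDE.IsClassicalEulerSolutionOn (Set.Iio 0) 0 u p ∧ T₁ ≤ 0 ∧ 0 ≤ M ∧ κ < 1 ∧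
        (∀ τ : ℝ, τ < T₁ → ∀ x : E3, ‖u τ x‖ ≤ M * (-τ) ^ (-κ))) ∧
      (1 - 3 * ρ) / (2 - 3 * ρ) < κ ∧
      ∃ τ : ℝ, τ < T₁ ∧ ∃ (χ : E3 → ℝ) (R : ℝ), 0 < R ∧
        (ContDiff ℝ ∞ χ ∧ (∀ x : E3, |χ x| ≤ 1) ∧ (∀ x : E3, R ≤ ‖x‖ → χ x = 0) ∧
            ∀ x : E3, fderiv ℝ χ x (Literature.Analysis.FluidPDE.curl (u τ) x) = 0) ∧
          (∫ x, χ x * inner ℝ (u τ x) (Literature.Analysis.FluidPDE.curl (u τ) x)) ≠ 0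

/-- CHIRAL TUBE PAST (ρ-free, ENVELOPE-free; line `chiral_anchor` of ns-idea-11 g10, its `IsChiralTubePast` VERBATIM with `IsTubeDatum`/`tubeHelicity` unfolded): classical Euler
on the open past, an anchor time `t₀ < 0` before which the velocity is bounded on every slab `[t₁,t₀] × ℝ³`, and a tube datum of the slice `u t₀` (a smooth cut-off `χ`, `|χ| ≤ 1`,
supported in `B(0,R)`, constant along the vorticity) with NON-ZERO weighted helicity.  ⊇ `IsHelicalTubePast ρ u p` for every ρ, κ < 1. -/
@[reducible] def IsChiralTubePast (u : ℝ → E3 → E3) (p : ℝ → E3 → ℝ) : Prop :=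
  Literature.Analysis.FluidPDE.IsClassicalEulerSolutionOn (Set.Iio 0) 0 u p ∧
    ∃ t₀ : ℝ, t₀ < 0 ∧
      (∀ t₁ : ℝ, t₁ < t₀ → ∃ B : ℝ, ∀ r ∈ Set.Icc t₁ t₀, ∀ x : E3, ‖u r x‖ ≤ B) ∧
      ∃ (χ : E3 → ℝ) (R : ℝ), 0 < R ∧
        (ContDiff ℝ ∞ χ ∧ (∀ x : E3, |χ x| ≤ 1) ∧ (∀ x : E3, R ≤ ‖x‖ → χ x = 0) ∧
          ∀ x : E3, fderiv ℝ χ x (Literature.Analysis.FluidPDE.curl (u t₀) x) = 0) ∧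
        (∫ x, χ x * inner ℝ (u t₀ x) (Literature.Analysis.FluidPDE.curl (u t₀) x)) ≠ 0

/-- STRETCHING-BUDGETED member — senses/credits: CENSUS-19832-vNN.md. -/
@[reducible] def IsStretchingBudgeted (ρ : ℝ) (u : ℝ → E3 → E3) (p : ℝ → E3 → ℝ) : Prop :=
  ∃ T₁ M κ K : ℝ, ∃ Λ : ℝ → ℝ,
    (Literature.Analysis.FluidPDE.IsClassicalEulerSolutionOn (Set.Iio 0) 0 u p ∧ T₁ ≤ 0 ∧ 0 ≤ M ∧ κ < 1 ∧
        (∀ τ : ℝ, τ < T₁ → ∀ x : E3, ‖u τ x‖ ≤ M * (-τ) ^ (-κ))) ∧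
      0 ≤ K ∧ K < min ((1 + ρ) / 4) ((κ + ρ - κ * ρ) / 2) ∧
      (MeasureTheory.IntegrableOn Λ (Set.Iio T₁) ∧ (∀ τ : ℝ, 0 ≤ Λ τ) ∧
        ∀ τ : ℝ, τ < T₁ → ∀ x : E3,
          inner ℝ (fderiv ℝ (u τ) x (Literature.Analysis.FluidPDE.curl (u τ) x)) (Literature.Analysis.FluidPDE.curl (u τ) x) ≤ (K / (-τ) + Λ τ) * ‖Literature.Analysis.FluidPDE.curl (u τ) x‖ ^ 2)

/-- ANCHORED-BUDGETED member (v52/v56 REV3 clause-free; line `anchored-budget` of ns-idea-11 g4; `AnchoredBudget.anchoredBudgeted_ae_eq_zero_rev3` p632310, ns-sfl-p1 g4 / ns-ezl-w2 g2) — senses/credits: CENSUS-19832-vNN.md. -/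
@[reducible] def IsAnchoredBudgeted (ρ : ℝ) (u : ℝ → E3 → E3) (p : ℝ → E3 → ℝ) : Prop :=
  ∃ (T₁ K : ℝ) (Λ : ℝ → ℝ),
    (Literature.Analysis.FluidPDE.IsClassicalEulerSolutionOn (Set.Iio 0) 0 u p ∧ T₁ ≤ 0) ∧
      0 ≤ K ∧ K < ρ / (1 + ρ) ∧
      (MeasureTheory.IntegrableOn Λ (Set.Iio T₁) ∧ (∀ τ : ℝ, 0 ≤ Λ τ) ∧
        ∀ τ : ℝ, τ < T₁ → ∀ x : E3,
          inner ℝ (fderiv ℝ (u τ) x (Literature.Analysis.FluidPDE.curl (u τ) x)) (Literature.Analysis.FluidPDE.curl (u τ) x) ≤ (K / (-τ) + Λ τ) * ‖Literature.Analysis.FluidPDE.curl (u τ) x‖ ^ 2)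

/-- CLASSICAL flow with CONFINED COMPACT VORTICITY (v37; line `vortex-volume` of ns-idea-11 g0; filler ns-ezl-w1 g0 `CompactVortex.ae_eq_zero_of_gauge_of_confinedVortex`):
classical Euler on the open past, vorticity slices supported in `B(0, κ(1+|τ|)^β)`, `κ > 0`, `β ≥ 0`, `β(1−ρ) < 1` (`β = 1`: bounded carrier; `β = 1/(2+ρ)`: self-similar spreading). -/
@[reducible] def IsConfinedVortex (ρ : ℝ) (u : ℝ → E3 → E3) (p : ℝ → E3 → ℝ) : Prop :=
  Literature.Analysis.FluidPDE.IsClassicalEulerSolutionOn (Set.Iio 0) 0 u p ∧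
    ∃ κ β : ℝ, 0 < κ ∧ 0 ≤ β ∧ β * (1 - ρ) < 1 ∧
      ∀ τ : ℝ, τ < 0 → Function.support (Literature.Analysis.FluidPDE.curl (u τ)) ⊆ Metric.ball (0 : E3) (κ * (1 + |τ|) ^ β)

/-- FADING TAME PAST, four landed senses (v37–v58; ns-ezl-w7 g0 p628272/p635832/p635104, ns-cas-k2 g0): (1) exponentially fading tame classical past; (2) algebraically fading
tame past `‖u‖ ≤ M(T₀−s)^{−m}`, `m > 1`; (3) steep-vorticity fading past; (4) tame negative-rate discrete clocks about a time `T` with one factor `μ > 1`. -/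
@[reducible] def IsFadingTamePast (u : ℝ → E3 → E3) (p : ℝ → E3 → ℝ) : Prop :=
  (∃ (T₁ c M C ε : ℝ) (x₀ : E3), T₁ ≤ 0 ∧ 0 < c ∧ 0 < ε ∧ Literature.Analysis.FluidPDE.IsClassicalEulerSolutionOn (Set.Iio T₁) 0 u p ∧
      (∀ s : ℝ, s < T₁ → ∀ y : E3, ‖u s y‖ ≤ M * Real.exp (c * s)) ∧
      (∀ s : ℝ, s < T₁ → ∀ y : E3, ‖fderiv ℝ (u s) y‖ ≤ C * (1 + Real.exp (-(c * s)) * ‖y - x₀‖) ^ (-ε))) ∨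
    (∃ (T₁ T₀ M m K : ℝ) (x₀ : E3), T₁ ≤ 0 ∧ T₁ ≤ T₀ ∧ 1 < m ∧
      Literature.Analysis.FluidPDE.IsClassicalEulerSolutionOn (Set.Iio T₁) 0 u p ∧
      (∀ s : ℝ, s < T₁ → ∀ y : E3, ‖u s y‖ ≤ M * (T₀ - s) ^ (-m)) ∧
      (∀ s : ℝ, s < T₁ → ∀ y : E3, ‖fderiv ℝ (u s) y‖ ≤ K) ∧
      (∀ δ : ℝ, 0 < δ → ∃ D k : ℝ, 1 < k ∧ ∀ s : ℝ, s < T₁ → ∀ y : E3, δ ≤ ‖y - x₀‖ → ‖fderiv ℝ (u s) y‖ ≤ D * (T₀ - s) ^ (-k))) ∨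
    (∃ T₁ c M C D k : ℝ, T₁ ≤ 0 ∧ 0 < c ∧ C < k * c ∧ Literature.Analysis.FluidPDE.IsClassicalEulerSolutionOn (Set.Iio T₁) 0 u p ∧
      (∀ s : ℝ, s < T₁ → ∀ y : E3, ‖u s y‖ ≤ M * Real.exp (c * s)) ∧
      (∀ s : ℝ, s < T₁ → ∀ y : E3, ‖fderiv ℝ (u s) y‖ ≤ C) ∧
      (∀ s : ℝ, s < T₁ → ∀ y : E3, ‖Literature.Analysis.FluidPDE.curl (u s) y‖ ≤ D * (1 + Real.exp (-(c * s)) * ‖y‖) ^ (-k))) ∨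
    (∃ T₁ T μ g B : ℝ, T₁ ≤ 0 ∧ T₁ ≤ T ∧ Literature.Analysis.FluidPDE.IsClassicalEulerSolutionOn (Set.Iio T₁) 0 u p ∧ 1 < μ ∧ g < 0 ∧
      (∀ τ : ℝ, τ < T₁ → ∀ x : E3, u τ x = μ ^ (1 - g) • u (T - μ * (T - τ)) (μ ^ g • x)) ∧
      (∀ τ : ℝ, T - μ * (T - T₁ + 1) ≤ τ → τ < T₁ → ∀ y : E3, ‖u τ y‖ ≤ B) ∧
      (∃ C q : ℝ, 0 < q ∧ ∀ τ : ℝ, T - μ * (T - T₁ + 1) ≤ τ → τ < T₁ → ∀ y : E3, ‖fderiv ℝ (u τ) y‖ ≤ C * (1 + ‖y‖) ^ (-q)))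

/-- FROZEN VORTICITY DIRECTION ON A FAR PAST (v38; line `frozen-direction`, ns-idea-11 g2): on some `(−∞, T₁)`, `T₁ ≤ 0`, directions `e(τ) ≠ 0` with
`⟪H(τ,x) e(τ), w⟫ = ⟪H(τ,x) w, e(τ)⟫` a.e. (classically `curl u(τ,·) ∥ e(τ)`; Giga–Miura's two-dimensional blow-up limit); filler `FrozenDirection.ae_eq_zero_of_gauge_of_pastFrozenDirection`. -/
@[reducible] def PastFrozenDirection (H : ℝ → E3 → E3 →L[ℝ] E3) : Prop :=
  ∃ T₁ : ℝ, T₁ ≤ 0 ∧ ∃ e : ℝ → E3, (∀ τ : ℝ, e τ ≠ 0) ∧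
    ∀ᵐ z ∂(volume.restrict (Set.Iio T₁ ×ˢ (Set.univ : Set E3))), ∀ w : E3, inner ℝ (H z.1 z.2 (e z.1)) w = inner ℝ (H z.1 z.2 w) (e z.1)

/-- ONE-SIDED PRESSURE ON A FAR PAST (v40; line `pressure-floor`, ns-idea-11 g2; `PressureFloor.ae_eq_zero_of_gauge_of_pastSlicewiseOneSided` with A2 `newtonianBumps`):
for some `T₁` and a.e. `t < T₁`, EITHER `p(t,·) ≥ −ε |u(t,·)|²` a.e. for some `ε < ρ/(1+ρ)` (relative floor; `ε = 0` = the zoom image of Seregin–Šverák's `p ≥ −g`) OR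
`p(t,·) ≤ −κ |u(t,·)|²` a.e. for some `κ > 1/(2+2ρ)` (relative ceiling). -/
@[reducible] def HasOneSidedPressurePast (ρ : ℝ) (u : ℝ → E3 → E3) (p : ℝ → E3 → ℝ) : Prop :=
  ∃ T₁ : ℝ, ∀ᵐ t ∂(volume.restrict (Set.Iio T₁)),
    (∃ ε : ℝ, ε < ρ / (1 + ρ) ∧ ∀ᵐ x ∂(volume : MeasureTheory.Measure E3), -ε * ‖u t x‖ ^ 2 ≤ p t x) ∨
      (∃ κ : ℝ, 1 / (2 + 2 * ρ) < κ ∧ ∀ᵐ x ∂(volume : MeasureTheory.Measure E3), p t x ≤ -κ * ‖u t x‖ ^ 2)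

/-- CONSERVATIVE EULER COLLAPSE INTO REST on `2/9 < ρ ≤ ½` (v74, line `extinct_trace` X2; credits: CENSUS files): final-window flux bound `∫∫_{(s,0)×B_a} |u|³ + 2|p||u| ≤ M a^{3/2−9ρ/4}`,
the local energy EQUALITY, and energy extinction `∫_{B_a}|u(τ)|² → 0` as `τ → 0⁻`; OR (v80) energy extinction with `u ∈ L⁴_loc` up to the final time. -/
@[reducible] def IsExtinctConservative (ρ : ℝ) (u : ℝ → E3 → E3) (p : ℝ → E3 → ℝ) : Prop :=
  2 / 9 < ρ ∧
    (∀ a : ℝ, 0 < a →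
      Filter.Tendsto (fun τ : ℝ => ∫⁻ x in Metric.ball (0 : E3) a, ‖u τ x‖ₑ ^ 2) (nhdsWithin (0 : ℝ) (Set.Iio 0)) (nhds 0)) ∧
    (((∀ s : ℝ, s < 0 → ∃ M : ℝ, 0 ≤ M ∧ ∀ a : ℝ, 1 ≤ a → -(a ^ 2) ≤ s →
        ∫⁻ z in Set.Ioo s 0 ×ˢ Metric.ball (0 : E3) a, (‖u z.1 z.2‖ₑ ^ (3 : ℕ) + 2 * (‖p z.1 z.2‖ₑ * ‖u z.1 z.2‖ₑ)) ≤
          ENNReal.ofReal (M * a ^ (3 / 2 - 9 * ρ / 4))) ∧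
      (∀ φ : ℝ → E3 → ℝ, Literature.Analysis.FluidPDE.IsSpaceTimeTestOn (Literature.Analysis.FluidPDE.slab E3 (Set.Iio 0) isOpen_Iio) φ →
        ∫ t, ∫ x, (‖u t x‖ ^ 2 * Literature.Analysis.FluidPDE.timeDeriv φ t x + (‖u t x‖ ^ 2 + 2 * p t x) * inner ℝ (u t x) (gradient (φ t) x)) = 0)) ∨
     (∀ a : ℝ, 0 < a →
        ∫⁻ z in Set.Ioo (-(a ^ 2)) 0 ×ˢ Metric.ball (0 : E3) a, ‖u z.1 z.2‖ₑ ^ (4 : ℕ) < ⊤))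

/-- TAME CLASSICAL SHAPE-PRESERVING flow — senses/credits: CENSUS-19832-vNN.md. -/
@[reducible] def IsTameClassicalShapePreserving (ρ : ℝ) (u : ℝ → E3 → E3) (p : ℝ → E3 → ℝ) : Prop :=
  Literature.Analysis.FluidPDE.IsClassicalEulerSolutionOn (Set.Iio 0) 0 u p ∧
    (∃ (θ ℓ : ℝ → ℝ) (V : E3 → E3),
      (∀ τ : ℝ, τ < 0 → 0 < θ τ ∧ 0 < ℓ τ) ∧ DifferentiableOn ℝ θ (Set.Iio 0) ∧ DifferentiableOn ℝ ℓ (Set.Iio 0) ∧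
        ∀ τ : ℝ, τ < 0 → ∀ y : E3, u τ y = θ τ • V ((ℓ τ)⁻¹ • y)) ∧
    (∀ (T₀ g : ℝ) (W : E3 → E3), 0 ≤ T₀ → (∀ τ : ℝ, τ < 0 → ∀ y : E3, u τ y = (T₀ - τ) ^ (g - 1) • W ((T₀ - τ) ^ (-g) • y)) →
      g < 2 / 5 ∨ 1 / (2 + ρ) < g ∨ (g < 1 / (2 + ρ) ∧ T₀ = 0))

/-- The weak profile has the (v42: SHELL) SPREAD at the endpoint `ρ = ½` — senses/credits: CENSUS-19832-vNN.md. -/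
@[reducible] def IsPowerSpreadProfile (V : E3 → E3) : Prop :=
  ((∃ δ Cup R₀ : ℝ, 0 < δ ∧ δ ≤ 1 ∧ 0 ≤ Cup ∧
      ∀ᵐ y ∂(volume : MeasureTheory.Measure E3), R₀ ≤ ‖y‖ → ‖V y‖ ≤ Cup * ‖y‖ ^ (1 - δ)) ∧
    ∃ c₀ η : ℝ, 0 < c₀ ∧ 0 < η ∧ ∀ L₁ : ℝ, ∃ L : ℝ, L₁ ≤ L ∧
      c₀ * L ^ (-(5 : ℝ) + η) ≤ ∫ y in {y : E3 | L ≤ ‖y‖ ∧ ‖y‖ < 2 * L}, ‖V y‖ ^ 2) ∨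
  (∃ c₀ η : ℝ, 0 < c₀ ∧ 5 / 2 < η ∧ ∀ L₁ : ℝ, ∃ L : ℝ, L₁ ≤ L ∧
      c₀ * L ^ (-(5 : ℝ) + η) ≤ ∫ y in {y : E3 | L ≤ ‖y‖ ∧ ‖y‖ < 2 * L}, ‖V y‖ ^ 2)

/-- DISCRETELY SELF-SIMILAR VELOCITY (factor `l > 1`: `u(τ,y) = l^{1+ρ} u(l^{2+ρ}τ, l y)`) with the POWER SPREAD on a period window (v20/v55/v58/v60; credits: CENSUS files):
the period-shell lower bound `∫_{window}∫_{L≤|y|<2L}|u|² ≥ c₀L^{−5+η}` beyond every bound (`η > 5/2`, or the v20 pointwise power lower bound) — CS13 Thm 3.1 for DSS members at `ρ = ½`. -/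
@[reducible] def IsDSSPowerSpread (ρ : ℝ) (u : ℝ → E3 → E3) : Prop :=
  ∃ l : ℝ, 1 < l ∧
    (∀ τ : ℝ, τ < 0 → ∀ y, u τ y = (l ^ (1 + ρ)) • u ((l ^ (2 + ρ)) * τ) (l • y)) ∧
    ∃ τ₀ : ℝ, τ₀ < 0 ∧
      (((∃ δ Cup R₀ : ℝ, 0 < δ ∧ δ ≤ 1 ∧ 0 ≤ Cup ∧
          ∀ᵐ τ : ℝ, τ ∈ Set.Ioo ((l ^ (2 + ρ)) * τ₀) τ₀ →
            ∀ᵐ y ∂(volume : MeasureTheory.Measure E3), R₀ ≤ ‖y‖ → ‖u τ y‖ ≤ Cup * ‖y‖ ^ (1 - δ)) ∧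
        ∃ c₀ η : ℝ, 0 < c₀ ∧ 0 < η ∧ ∀ L₁ : ℝ, ∃ L : ℝ, L₁ ≤ L ∧
          c₀ * L ^ (-(5 : ℝ) + η) ≤
            ∫ τ in Set.Ioo ((l ^ (2 + ρ)) * τ₀) τ₀, ∫ y in {y : E3 | L ≤ ‖y‖ ∧ ‖y‖ < 2 * L}, ‖u τ y‖ ^ 2) ∨
      (∃ c₀ η : ℝ, 0 < c₀ ∧ 5 / 2 < η ∧ ∀ L₁ : ℝ, ∃ L : ℝ, L₁ ≤ L ∧
          c₀ * L ^ (-(5 : ℝ) + η) ≤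
            ∫ τ in Set.Ioo ((l ^ (2 + ρ)) * τ₀) τ₀, ∫ y in {y : E3 | L ≤ ‖y‖ ∧ ‖y‖ < 2 * L}, ‖u τ y‖ ^ 2))

/-- The member is a CLASSICAL DISCRETELY SELF-SIMILAR flow WITH COMPACTLY SUPPORTED VORTICITY (v21) — senses/credits: CENSUS-19832-vNN.md. -/
@[reducible] def IsDSSCompactVorticity (ρ : ℝ) (u : ℝ → E3 → E3) (p : ℝ → E3 → ℝ) : Prop :=
  Literature.Analysis.FluidPDE.IsClassicalEulerSolutionOn (Set.Iio 0) 0 u p ∧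
    ∃ l : ℝ, 1 < l ∧
      (∀ τ : ℝ, τ < 0 → ∀ y, u τ y = (l ^ (1 + ρ)) • u ((l ^ (2 + ρ)) * τ) (l • y)) ∧
      ∀ τ₁ τ₂ : ℝ, τ₁ ≤ τ₂ → τ₂ < 0 → ∃ K : Set E3,
        IsCompact K ∧ ∀ σ ∈ Set.Icc τ₁ τ₂, ∀ x ∉ K, Literature.Analysis.FluidPDE.vorticity u σ x = 0

/-- CLASSICAL DSS member, VORTICITY-TAME in one of ten landed senses — senses/credits: CENSUS-19832-vNN.md. -/
@[reducible] def IsDSSClassicalTame (ρ : ℝ) (u : ℝ → E3 → E3) (p : ℝ → E3 → ℝ) : Prop :=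
  Literature.Analysis.FluidPDE.IsClassicalNSSolutionOn (Set.Iio 0) 0 0 u p ∧
    ∃ l : ℝ, 1 < l ∧
      (∀ τ : ℝ, τ < 0 → ∀ y, u τ y = (l ^ (1 + ρ)) • u ((l ^ (2 + ρ)) * τ) (l • y)) ∧
      (∀ s t : ℝ, s < t → t < 0 → ∃ B : ℝ, ∀ τ ∈ Set.Icc s t, ∀ y : E3, ‖u τ y‖ ≤ B ∧ ‖fderiv ℝ (u τ) y‖ ≤ B) ∧
      ((∀ q₀ : ℝ, 0 < q₀ → ∃ q : ℝ, 0 < q ∧ q < q₀ ∧ ∀ s t : ℝ, s < t → t < 0 → ∃ N : ℝ, ∀ τ ∈ Set.Icc s t,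
          Integrable (fun y => ‖Literature.Analysis.FluidPDE.curl (u τ) y‖ ^ q) ∧ ∫ y, ‖Literature.Analysis.FluidPDE.curl (u τ) y‖ ^ q ≤ N) ∨
        ((∀ τ : ℝ, τ < 0 → Literature.Analysis.FluidPDE.IsAxisymmetric (u τ)) ∧
          ∃ k : ℕ, 1 ≤ k ∧ 2 * (k : ℝ) * ρ ≠ 3 ∧
            (∀ s t : ℝ, s < t → t < 0 → ∃ N : ℝ, ∀ τ ∈ Set.Icc s t,
              Integrable (fun y => (Literature.Analysis.FluidPDE.swirl (u τ) y ^ k) ^ 2) ∧ ∫ y, (Literature.Analysis.FluidPDE.swirl (u τ) y ^ k) ^ 2 ≤ N) ∧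
            ∃ m : ℕ, 1 ≤ m ∧ (∀ s t : ℝ, s < t → t < 0 → ∃ N : ℝ, ∀ τ ∈ Set.Icc s t,
              Integrable (fun y => (Literature.Analysis.FluidPDE.angVortQuot (u τ) y ^ m) ^ 2) ∧ ∫ y, (Literature.Analysis.FluidPDE.angVortQuot (u τ) y ^ m) ^ 2 ≤ N)) ∨
        ((∀ τ : ℝ, τ < 0 → Literature.Analysis.FluidPDE.IsAxisymmetric (u τ)) ∧ (∀ τ : ℝ, τ < 0 → Literature.Analysis.FluidPDE.HasNoSwirl (u τ)) ∧
          ∃ m : ℕ, 1 ≤ m ∧ (∀ s t : ℝ, s < t → t < 0 → ∃ N : ℝ, ∀ τ ∈ Set.Icc s t,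
              Integrable (fun y => (Literature.Analysis.FluidPDE.angVortQuot (u τ) y ^ m) ^ 2) ∧ ∫ y, (Literature.Analysis.FluidPDE.angVortQuot (u τ) y ^ m) ^ 2 ≤ N)) ∨
        (∃ q : ℝ, 0 < q ∧ q * (2 + ρ) < 3 ∧
          (∀ s t : ℝ, s < t → t < 0 → ∃ N : ℝ, ∀ τ ∈ Set.Icc s t,
              Integrable (fun y => ‖Literature.Analysis.FluidPDE.curl (u τ) y‖ ^ q) ∧ ∫ y, ‖Literature.Analysis.FluidPDE.curl (u τ) y‖ ^ q ≤ N) ∧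
          ∃ τs : ℝ, τs < 0 ∧ ∀ η : ℝ, 0 < η → ∃ R : ℝ, ∀ τ ∈ Set.Icc (l ^ (2 + ρ) * τs) τs, ∀ y : E3,
              R ≤ ‖y‖ → ‖fderiv ℝ (u τ) y‖ ≤ η) ∨
        (∃ q R₀ δ : ℝ, 0 < q ∧ 0 < R₀ ∧ 0 ≤ δ ∧
          (∀ s t : ℝ, s < t → t < 0 → ∃ N : ℝ, ∀ τ ∈ Set.Icc s t,
              Integrable (fun y => ‖Literature.Analysis.FluidPDE.curl (u τ) y‖ ^ q) ∧ ∫ y, ‖Literature.Analysis.FluidPDE.curl (u τ) y‖ ^ q ≤ N) ∧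
          (∀ τ : ℝ, τ < 0 → ∀ y : E3, R₀ * (-τ) ^ (2 + ρ)⁻¹ ≤ ‖y‖ →
              (-τ) * ‖fderiv ℝ (u τ) y‖ ≤ δ ∧ (-τ) * ‖u τ y‖ ≤ (2 + ρ)⁻¹ * ‖y‖) ∧
          1 < (1 - q * δ * (l ^ (2 + ρ) - 1)) * l ^ (3 - q * (2 + ρ))) ∨
        (∃ θ : ℝ, θ < 1 ∧
          (∀ s : ℝ, s < 0 → ∀ x : E3,
            (-s) * Literature.Analysis.FluidPDE.timeDerivWithin (Set.Iio 0) p s x - (2 + ρ)⁻¹ * fderiv ℝ (p s) x x -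
                2 * (1 - (2 + ρ)⁻¹) * p s x ≤
              θ * (1 - 2 * (2 + ρ)⁻¹) * ‖u s x + ((2 + ρ)⁻¹ / (-s)) • x‖ ^ 2) ∧
          ((∀ R : ℝ, 0 < R → ∃ P₀ G : ℝ, ∀ s : ℝ, s < 0 → ∀ x : E3, ‖x‖ ≤ R * (-s) ^ (2 + ρ)⁻¹ →
              (-s) ^ (2 - 2 * (2 + ρ)⁻¹) * p s x ≤ P₀ ∧ (-s) ^ (2 - (2 + ρ)⁻¹) * ‖gradient (p s) x‖ ≤ G) ∨
            (∀ τ : ℝ, τ < 0 → ∀ y : E3, p τ y = l ^ (2 + 2 * ρ) * p ((l ^ (2 + ρ)) * τ) (l • y))) ∧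
          (∀ y : E3, (∀ t : ℝ, t < 0 → u t ((-t) ^ (2 + ρ)⁻¹ • y) = (-((2 + ρ)⁻¹ * (-t) ^ ((2 + ρ)⁻¹ - 1))) • y) →
            ∀ t : ℝ, t < 0 → ∀ v : E3, v ≠ 0 → (-t) * inner ℝ (fderiv ℝ (u t) ((-t) ^ (2 + ρ)⁻¹ • y) v) v < ‖v‖ ^ 2)) ∨
        (∃ θ : ℝ, θ < 1 ∧
          (∀ s : ℝ, s < 0 → ∀ x : E3,
            (-s) * Literature.Analysis.FluidPDE.timeDerivWithin (Set.Iio 0) p s x - (2 + ρ)⁻¹ * fderiv ℝ (p s) x x -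
                2 * (1 - (2 + ρ)⁻¹) * p s x ≤
              θ * (1 - 2 * (2 + ρ)⁻¹) * ‖u s x + ((2 + ρ)⁻¹ / (-s)) • x‖ ^ 2) ∧
          (∀ τ : ℝ, τ < 0 → ∀ y : E3, p τ y = l ^ (2 + 2 * ρ) * p ((l ^ (2 + ρ)) * τ) (l • y)) ∧
          (∀ R : ℝ, {y : E3 | ‖y‖ ≤ R ∧
            ∀ t : ℝ, t < 0 → u t ((-t) ^ (2 + ρ)⁻¹ • y) = (-((2 + ρ)⁻¹ * (-t) ^ ((2 + ρ)⁻¹ - 1))) • y}.Countable)) ∨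
        ((∀ τ : ℝ, τ < 0 → Literature.Analysis.FluidPDE.IsAxisymmetric (u τ)) ∧
          ∃ τ₀ : ℝ, τ₀ < 0 ∧
            ((∃ B : ℝ, ∀ y : E3, |Literature.Analysis.FluidPDE.swirl (u τ₀) y| ≤ B) ∨ MeasureTheory.volume {y : E3 | Literature.Analysis.FluidPDE.swirl (u τ₀) y ≠ 0} < ⊤ ∨
              ∃ q : ℝ, 0 < q ∧ q * ρ ≠ 3 ∧ ∫⁻ y, ENNReal.ofReal (|Literature.Analysis.FluidPDE.swirl (u τ₀) y| ^ q) < ⊤) ∧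
            ((∃ B : ℝ, ∀ y : E3, |Literature.Analysis.FluidPDE.angVortQuot (u τ₀) y| ≤ B) ∨ MeasureTheory.volume {y : E3 | Literature.Analysis.FluidPDE.angVortQuot (u τ₀) y ≠ 0} < ⊤ ∨
              ∃ q : ℝ, 0 < q ∧ q * (3 + ρ) ≠ 3 ∧ ∫⁻ y, ENNReal.ofReal (|Literature.Analysis.FluidPDE.angVortQuot (u τ₀) y| ^ q) < ⊤)) ∨
        (∃ τ₀ : ℝ, τ₀ < 0 ∧ MeasureTheory.volume {y : E3 | Literature.Analysis.FluidPDE.curl (u τ₀) y ≠ 0} < ⊤))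

/-- CLASSICAL DSS member in an ENERGY stratum (v35) — senses/credits: CENSUS-19832-vNN.md. -/
@[reducible] def IsDSSClassicalEnergy (ρ : ℝ) (u : ℝ → E3 → E3) (p : ℝ → E3 → ℝ) : Prop :=
  Literature.Analysis.FluidPDE.IsClassicalNSSolutionOn (Set.Iio 0) 0 0 u p ∧
    ∃ l : ℝ, 1 < l ∧
      (∀ τ : ℝ, τ < 0 → ∀ y, u τ y = (l ^ (1 + ρ)) • u ((l ^ (2 + ρ)) * τ) (l • y)) ∧
      ((ρ ≠ 1 / 2 ∧ ∀ s t : ℝ, s < t → t < 0 → ∃ M : ℝ, ∀ τ ∈ Set.Icc s t,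
          (Integrable (fun y => ‖u τ y‖ ^ 2) ∧ ∫ y, ‖u τ y‖ ^ 2 ≤ M) ∧
          (Integrable (fun y => ‖u τ y‖ ^ 3) ∧ ∫ y, ‖u τ y‖ ^ 3 ≤ M) ∧
          (Integrable (fun y => |p τ y| * ‖u τ y‖) ∧ ∫ y, |p τ y| * ‖u τ y‖ ≤ M)) ∨
       (∃ K R₀ γ β τ₀ : ℝ, 0 ≤ K ∧ 0 ≤ R₀ ∧ 0 ≤ γ ∧ β < 1 ∧
          (∀ τ : ℝ, τ < 0 → ∀ R : ℝ, 0 < R → R₀ * (-τ) ^ γ ≤ R →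
            ∫ x in {y : E3 | R ≤ ‖y‖ ∧ ‖y‖ ≤ 2 * R}, (‖u τ x‖ ^ 3 + 2 * |p τ x| * ‖u τ x‖) ≤ K * R ^ β) ∧
          τ₀ < 0 ∧
          (∀ ε : ℝ, 0 < ε → ∀ Rbar : ℝ, ∃ R : ℝ, Rbar ≤ R ∧
            R ^ (2 * ρ - 1) * ∫ x in Metric.ball (0 : E3) R, ‖u τ₀ x‖ ^ 2 ≤ ε)))

/-- FLUX-TAME IN THE WEAK CLASS (v35): EITHER finite backward Bernoulli flux `(|u|³ + 2|p||u|)/max(1,|x|) ∈ L¹((−∞, b) × ℝ³)` for every `b < 0`, OR Bernoulli flux OUTWARD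
a.e. (`0 ≤ (|u|² + 2p)⟪u, x⟫`), OR a TIME-PERIODIC weak gradient `H(t − P, x) = H(t, x)` for `t < 0`. -/
@[reducible] def IsWeakFluxTame (u : ℝ → E3 → E3) (p : ℝ → E3 → ℝ) (H : ℝ → E3 → E3 →L[ℝ] E3) : Prop :=
  (∀ b : ℝ, b < 0 → IntegrableOn
      (fun z : ℝ × E3 => (‖u z.1 z.2‖ ^ 3 + 2 * |p z.1 z.2| * ‖u z.1 z.2‖) / max 1 ‖z.2‖)
      (Set.Iio b ×ˢ (Set.univ : Set E3)) volume) ∨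
    (∀ᵐ z ∂(volume.restrict (Set.Iio (0 : ℝ) ×ˢ (Set.univ : Set E3))),
      0 ≤ (‖u z.1 z.2‖ ^ 2 + 2 * p z.1 z.2) * inner ℝ (u z.1 z.2) z.2) ∨
    ∃ P : ℝ, 0 < P ∧ ∀ t : ℝ, t < 0 → ∀ x : E3, H (t - P) x = H t x

/-- VORTICITY-TAME (v24/v26/v33): an irrotational incompressible `C²` past below some `T₁ ≤ 0` (`PastIrrotational.…`), OR classical Euler on `(−∞, T₁)` with a Type-I gradient
bound `‖∇u‖ ≤ K'/(−τ)` and EITHER an eventually small Type-I gradient (`K < 1`) OR a sub-unit vortex-stretching rate `⟪∇u ω, ω⟫ ≤ K‖ω‖²/(−τ)`, `K < 1` (`PastKelvin.…` p601362). -/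
@[reducible] def IsClassicalVorticityTame (u : ℝ → E3 → E3) (p : ℝ → E3 → ℝ) : Prop :=
  (∃ T₁ : ℝ, T₁ ≤ 0 ∧ ∀ τ : ℝ, τ < T₁ →
      ContDiff ℝ 2 (u τ) ∧ Literature.Analysis.FluidPDE.VectorCalculus.IsDivFree (u τ) ∧
        ∀ x : E3, Literature.Analysis.FluidPDE.curl (u τ) x = 0) ∨
    (∃ (T₁ : ℝ) (Λ : ℝ → ℝ), T₁ ≤ 0 ∧ Literature.Analysis.FluidPDE.IsClassicalEulerSolutionOn (Set.Iio T₁) 0 u p ∧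
      ContinuousOn Λ (Set.Iio T₁) ∧ (∀ s : ℝ, s < T₁ → ∀ y : E3, ‖fderiv ℝ (u s) y‖ ≤ Λ s) ∧
      ∀ T : ℝ, T < T₁ → ∀ ε : ℝ, 0 < ε → ∀ S : ℝ, ∃ s : ℝ, s < S ∧ s < T ∧
        ∀ y : E3, Real.exp (∫ σ in s..T, Λ σ) * ‖Literature.Analysis.FluidPDE.curl (u s) y‖ ≤ ε) ∨
    ∃ T₁ : ℝ, T₁ ≤ 0 ∧ Literature.Analysis.FluidPDE.IsClassicalEulerSolutionOn (Set.Iio T₁) 0 u p ∧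
      (∃ K' : ℝ, ∀ τ : ℝ, τ < T₁ → ∀ x : E3, ‖fderiv ℝ (u τ) x‖ ≤ K' / (-τ)) ∧
        ((∃ K T₀ : ℝ, K < 1 ∧ ∀ τ : ℝ, τ < T₀ → ∀ x : E3, ‖fderiv ℝ (u τ) x‖ ≤ K / (-τ)) ∨
          ∃ K : ℝ, K < 1 ∧ ∀ τ : ℝ, τ < T₁ → ∀ x : E3,
            inner ℝ (fderiv ℝ (u τ) x (Literature.Analysis.FluidPDE.curl (u τ) x)) (Literature.Analysis.FluidPDE.curl (u τ) x) ≤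
              K / (-τ) * ‖Literature.Analysis.FluidPDE.curl (u τ) x‖ ^ 2)

/-- SYMMETRIC IN THE WEAK CLASS (v25): time-periodic (⊇ steady), OR a traveling wave with traveling weak gradient, OR screw-symmetric / space-periodic in modulus — binder shapes
of `TimePeriodic.…_timePeriodic`, `TravelingWave.…_travelingWave`, `ScrewSymmetric.…_screwSymmetric` (gauge arithmetic only). -/
@[reducible] def IsSymmetricWeak (u : ℝ → E3 → E3) (H : ℝ → E3 → E3 →L[ℝ] E3) : Prop :=
  (∃ P : ℝ, 0 < P ∧ ∀ τ : ℝ, τ < 0 → u (τ - P) = u τ) ∨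
    (∃ (U : E3 → E3) (G₀ : E3 → E3 →L[ℝ] E3) (b : E3),
        u = (fun τ y => U (y - τ • b)) ∧ H = fun τ y => G₀ (y - τ • b)) ∨
    ∃ (L : E3 ≃ₗᵢ[ℝ] E3) (y₀ w : E3), w ≠ 0 ∧ L w = w ∧ ∀ τ : ℝ, τ < 0 → ∀ y : E3, ‖u τ (L (y - y₀) + y₀ + w)‖ = ‖u τ y‖

/-- The member is CLASSICAL AND CONCENTRATING AT THE CLASS RATE — senses/credits: CENSUS-19832-vNN.md. -/
@[reducible] def IsClassicalConcentrating (ρ : ℝ) (u : ℝ → E3 → E3) (p : ℝ → E3 → ℝ) : Prop :=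
  Literature.Analysis.FluidPDE.IsClassicalEulerSolutionOn (Set.Iio 0) 0 u p ∧
    (∃ M : ℝ, ∀ τ : ℝ, τ < 0 → ∀ x, ‖u τ x‖ ≤ M * (-τ) ^ (1 / (2 + ρ) - 1)) ∧
    (∃ K : ℝ, ∀ τ : ℝ, τ < 0 → ∀ x, ‖fderiv ℝ (u τ) x‖ ≤ K / (-τ)) ∧
    (∀ ε : ℝ, 0 < ε → ∃ R : ℝ, 0 ≤ R ∧ ∀ τ : ℝ, τ < 0 → ∀ x : E3,
      R * (-τ) ^ (1 / (2 + ρ)) ≤ ‖x‖ → ‖fderiv ℝ (u τ) x‖ ≤ ε / (-τ)) ∧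
    (∃ β C R₀ : ℝ, 0 < β ∧ 0 ≤ R₀ ∧ ∀ τ : ℝ, τ < 0 → ∀ r : ℝ, R₀ * (-τ) ^ (1 / (2 + ρ)) ≤ r →
      ∫ x in {x | r ≤ ‖x‖}, ‖u τ x‖ ^ 2 ≤ C * r ^ (-β) * (-τ) ^ (1 / (2 + ρ) * β)) ∧
    (∀ τ : ℝ, τ < 0 → MeasureTheory.Integrable (fun x => ‖u τ x‖ ^ 2) volume)

/-- WEAK-CURL STRATA, five senses, REGULARITY-FREE (W-CV p690763 / p691156, W-IV p692391, weak_eulerian E3 p698147, weak_axisym p705122/p704941/p709301/p702731): confined curl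
(weak-gradient or intrinsic sense, ρ < ½), integrable curl (ρ < ½), vorticity support of density zero (every ρ; v113 geometric, E2 discharged), and (v112 geometric, v115 ANY AXIS) the UKHOVSKII–YUDOVICH
AXISYMMETRIC SWIRL-FREE weak stratum about ANY axis, with Casimir `η ∈ L²_loc` of sub-linear growth (every ρ) — full texts and credits: CENSUS-19832-v107/v110/v112.md. -/
@[reducible] def IsWeakConfinedCurl (ρ : ℝ) (V : E3 → E3) : Prop :=
  (ρ < 1 / 2 ∧
    ((∃ (G : E3 → E3 →L[ℝ] E3) (R₀ : ℝ),
        Literature.Analysis.FunctionSpaces.HasWeakFDerivOn (⊤ : TopologicalSpace.Opens E3) volume V G ∧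
          ∀ᵐ y ∂(volume : Measure E3), R₀ < ‖y‖ → ∀ v w : E3, inner ℝ (G y v) w = inner ℝ (G y w) v) ∨
      (∃ R₀ : ℝ, ∀ g : E3 → ℝ, Literature.Analysis.FunctionSpaces.IsTestFunctionOn (⊤ : TopologicalSpace.Opens E3) g →
        tsupport g ⊆ {y : E3 | R₀ < ‖y‖} → ∀ a b : E3, ∫ x, inner ℝ (V x) (fderiv ℝ g x a • b - fderiv ℝ g x b • a) = 0) ∨
      ∃ G : E3 → E3 →L[ℝ] E3, Literature.Analysis.FunctionSpaces.HasWeakFDerivOn (⊤ : TopologicalSpace.Opens E3) volume V G ∧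
        Integrable (fun y => Literature.Analysis.FluidPDE.curlCLM (G y)) volume ∧
          MemLp (fun y => Literature.Analysis.FluidPDE.curlCLM (G y)) 2 volume)) ∨
  (∃ G : E3 → E3 →L[ℝ] E3,
    (Literature.Analysis.FunctionSpaces.HasWeakFDerivOn (⊤ : TopologicalSpace.Opens E3) volume V G ∧
      (∀ r : ℝ, MemLp G 2 (volume.restrict (Metric.ball (0 : E3) r))) ∧
      (∀ r : ℝ, MemLp V 6 (volume.restrict (Metric.ball (0 : E3) r))) ∧
      Literature.Analysis.FunctionSpaces.HasWeakFDerivOn (⊤ : TopologicalSpace.Opens E3) volume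
        (Literature.Analysis.FluidPDE.selfSimilarTransport (1 / (2 + ρ)) 0 V)
        (fun x => (1 / (2 + ρ)) • ContinuousLinearMap.id ℝ E3 + G x)) ∧
    (∀ φ : E3 → ℝ, Literature.Analysis.FunctionSpaces.IsTestFunctionOn (⊤ : TopologicalSpace.Opens E3) φ →
      ∫ y, inner ℝ (Literature.Analysis.FluidPDE.selfSimilarTransport (1 / (2 + ρ)) 0 V y) (gradient φ y) = -(3 * (1 / (2 + ρ))) * ∫ y, φ y) ∧
    Filter.Tendsto (fun R : ℝ => (volume : Measure E3) ({y : E3 | Literature.Analysis.FluidPDE.curlCLM (G y) ≠ 0} ∩ Metric.ball (0 : E3) R) /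
        (volume : Measure E3) (Metric.ball (0 : E3) R)) Filter.atTop (nhds 0)) ∨
  (∃ (R : E3 ≃ₗᵢ[ℝ] E3) (G : E3 → E3 →L[ℝ] E3),
    (Literature.Analysis.FunctionSpaces.HasWeakFDerivOn (⊤ : TopologicalSpace.Opens E3) volume (fun y => R (V (R.symm y))) G ∧
      (∀ r : ℝ, MemLp G 2 (volume.restrict (Metric.ball (0 : E3) r))) ∧
      (∀ r : ℝ, MemLp (fun y => R (V (R.symm y))) 6 (volume.restrict (Metric.ball (0 : E3) r))) ∧
      Literature.Analysis.FunctionSpaces.HasWeakFDerivOn (⊤ : TopologicalSpace.Opens E3) volume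
        (Literature.Analysis.FluidPDE.selfSimilarTransport (1 / (2 + ρ)) 0 (fun y => R (V (R.symm y))))
        (fun x => (1 / (2 + ρ)) • ContinuousLinearMap.id ℝ E3 + G x)) ∧
    (∀ φ : E3 → ℝ, Literature.Analysis.FunctionSpaces.IsTestFunctionOn (⊤ : TopologicalSpace.Opens E3) φ →
      ∫ y, inner ℝ (Literature.Analysis.FluidPDE.selfSimilarTransport (1 / (2 + ρ)) 0 (fun y => R (V (R.symm y))) y) (gradient φ y) = -(3 * (1 / (2 + ρ))) * ∫ y, φ y) ∧
    ((∀ᵐ y ∂(volume : Measure E3), G y (WithLp.toLp 2 ![-(y 1), y 0, 0]) = WithLp.toLp 2 ![-((fun y => R (V (R.symm y))) y 1), (fun y => R (V (R.symm y))) y 0, 0]) ∧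
      (∀ᵐ y ∂(volume : Measure E3), inner ℝ ((fun y => R (V (R.symm y))) y) (WithLp.toLp 2 ![-(y 1), y 0, 0]) = 0) ∧
      (∀ r : ℝ, MemLp (fun y => inner ℝ ((fun y => R (V (R.symm y))) y) (WithLp.toLp 2 ![y 0, y 1, 0]) / (y 0 ^ 2 + y 1 ^ 2)) 2 (volume.restrict (Metric.ball (0 : E3) r))) ∧
      (∀ r : ℝ, MemLp (fun y => inner ℝ (Literature.Analysis.FluidPDE.curlCLM (G y)) (WithLp.toLp 2 ![-(y 1), y 0, 0]) / (y 0 ^ 2 + y 1 ^ 2)) 2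
        (volume.restrict (Metric.ball (0 : E3) r))) ∧
      (∃ C m : ℝ, m < 1 ∧ ∀ R : ℝ, 1 ≤ R →
        ∫ y in Metric.ball (0 : E3) R, (inner ℝ (Literature.Analysis.FluidPDE.curlCLM (G y)) (WithLp.toLp 2 ![-(y 1), y 0, 0]) / (y 0 ^ 2 + y 1 ^ 2)) ^ 2 ≤ C * R ^ m)))

end Summit.NavierStokesRegularity.NavierStokesRegularity.Theorems.PowerGaugeEulerLiouville.Birth

end
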